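import Mathlib

/-!
# `PlanarSAZylev` (crux `stmt-KontsevichZagierPeriods-9848`), line `reservoir-peeling`:
# a rational function on `ℝ²` that is differentiable everywhere but not `C¹`
# (negative-side support, drefute seat)

`f (x, y) = x² y² / (x⁴ + y²)` (Lean's `0/0 = 0` supplies `f 0 = 0`) is a rational — hence
`ℚ`-semialgebraic — function on `ℝ²`, differentiable at EVERY point (at the origin with derivative `0`,
since `|f| ≤ x²`), whose derivative is NOT continuous at the origin: along the parabola `(t, t²)` the
partial derivative `∂f/∂y = 2x⁶y/(x⁴+y²)²` is identically `1/2`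
(`differentiable_and_not_contDiff`).

Relevance for the line's `stub_assembly` (decoding of the group hypothesis): a
`KZ.changeOfVariablesRel` generator only provides `HasFDerivWithinAt Φ (Φ' x) σ x` at every point of a
possibly non-open domain, while the pinned relation `E` of the skeleton wants `ContDiffOn ℝ 1 Φ U` on an
open co-null `U`. "Semialgebraic and differentiable everywhere, hence `C¹`" is FALSE in dimension `2`
(it is true in dimension `1`); the `C¹` locus must be obtained by deleting the thin singular set
(`Literature.NumberTheory.Transcendental.KZ.exists_isOpen_contDiffOn`: open `ℚ`-semialgebraic `G ⊆ D`,
`C^∞` on `G`, `D ∖ G` semialgebraic and null), never pointwise. Mathlib only.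
-/

noncomputable section

open Filter Topology Asymptotics Set Function

set_option linter.dupNamespace false

namespace Summit.KontsevichZagierPeriods.KontsevichZagierPeriods.Theorems.PlanarSAZylev.Negative.NonC1

/-- The function `x² y² / (x⁴ + y²)` on `ℝ²` (coordinates `p 0 = x`, `p 1 = y`; value `0` at the origin). -/
def f (p : Fin 2 → ℝ) : ℝ := p 0 ^ 2 * p 1 ^ 2 / (p 0 ^ 4 + p 1 ^ 2)

/-- `f 0 = 0` (junk value of the division). -/
theorem f_zero : f 0 = 0 := by simp [f]

/-- The key bound `|f p| ≤ (p 0)²`. -/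
theorem abs_f_le (p : Fin 2 → ℝ) : |f p| ≤ p 0 ^ 2 := by
  unfold f
  have h4 : (0 : ℝ) ≤ p 0 ^ 4 := by positivity
  rcases eq_or_lt_of_le (add_nonneg h4 (sq_nonneg (p 1)) : (0:ℝ) ≤ p 0 ^ 4 + p 1 ^ 2) with h | h
  · rw [← h]; simp [sq_nonneg]
  · rw [abs_div, abs_of_pos h, div_le_iff₀ h, abs_of_nonneg (by positivity)]
    nlinarith [sq_nonneg (p 0), sq_nonneg (p 1), h4, mul_nonneg (sq_nonneg (p 0)) h4]

/-- `|f p| ≤ ‖p‖²`. -/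
theorem abs_f_le_norm_sq (p : Fin 2 → ℝ) : |f p| ≤ ‖p‖ ^ 2 := by
  refine (abs_f_le p).trans ?_
  have h : |p 0| ≤ ‖p‖ := by simpa using norm_le_pi_norm p 0
  calc p 0 ^ 2 = |p 0| ^ 2 := (sq_abs _).symm
    _ ≤ ‖p‖ ^ 2 := pow_le_pow_left₀ (abs_nonneg _) h 2

/-- `f` is differentiable at the origin, with derivative `0`. -/
theorem hasFDerivAt_f_zero : HasFDerivAt f (0 : (Fin 2 → ℝ) →L[ℝ] ℝ) 0 := by
  rw [hasFDerivAt_iff_isLittleO_nhds_zero]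
  simp only [zero_add, f_zero, sub_zero, zero_apply]
  have h1 : (fun h : Fin 2 → ℝ => f h) =O[𝓝 0] fun h => ‖h‖ ^ 2 :=
    IsBigO.of_bound 1 (Eventually.of_forall fun h => by
      simpa [Real.norm_eq_abs, abs_of_nonneg (sq_nonneg ‖h‖)] using abs_f_le_norm_sq h)
  have h2 : (fun h : Fin 2 → ℝ => ‖h‖ ^ 2) =o[𝓝 0] fun h => h := isLittleO_norm_pow_id one_lt_two
  exact h1.trans_isLittleO h2

/-- The point `(t, t²)` of the parabola. -/
def c (t : ℝ) : Fin 2 → ℝ := ![t, t ^ 2]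

/-- Abscissa of the parabola point. -/
@[simp] theorem c_zero_apply (t : ℝ) : c t 0 = t := rfl

/-- Ordinate of the parabola point. -/
@[simp] theorem c_one_apply (t : ℝ) : c t 1 = t ^ 2 := rfl

/-- Off the origin `f` is differentiable (rational function with non-vanishing denominator). -/
theorem differentiableAt_f {p : Fin 2 → ℝ} (hp : p 0 ^ 4 + p 1 ^ 2 ≠ 0) : DifferentiableAt ℝ f p := by
  unfold f
  fun_prop (disch := exact hp)

/-- The partial derivative `∂f/∂y` at `(t, t²)`, `t ≠ 0`, is `1/2`. -/
theorem hasDerivAt_f_slice {t : ℝ} (ht : t ≠ 0) :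
    HasDerivAt (fun s : ℝ => f (Function.update (c t) 1 s)) (1 / 2) (t ^ 2) := by
  have hfun : (fun s : ℝ => f (Function.update (c t) 1 s)) = fun s => t ^ 2 * s ^ 2 / (t ^ 4 + s ^ 2) := by
    funext s
    simp [f, Function.update_self]
  rw [hfun]
  have hden : t ^ 4 + (t ^ 2) ^ 2 ≠ 0 := by positivity
  have h1 : HasDerivAt (fun s : ℝ => t ^ 2 * s ^ 2) (t ^ 2 * (2 * t ^ 2)) (t ^ 2) := by
    simpa using ((hasDerivAt_pow 2 (t ^ 2)).const_mul (t ^ 2))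
  have h2 : HasDerivAt (fun s : ℝ => t ^ 4 + s ^ 2) (2 * t ^ 2) (t ^ 2) := by
    simpa using ((hasDerivAt_pow 2 (t ^ 2)).const_add (t ^ 4))
  refine (h1.div h2 hden).congr_deriv ?_
  field_simp
  ring

/-- Hence the Fréchet derivative at `(t, t²)` evaluated on `e₁ = (0, 1)` is `1/2` (chain rule along the slice). -/
theorem fderiv_f_c_apply {t : ℝ} (ht : t ≠ 0) : fderiv ℝ f (c t) (Pi.single 1 1) = 1 / 2 := by
  have hp : (c t) 0 ^ 4 + (c t) 1 ^ 2 ≠ 0 := by simp; positivity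
  have hF : HasFDerivAt f (fderiv ℝ f (c t)) (c t) := (differentiableAt_f hp).hasFDerivAt
  have hct : Function.update (c t) 1 (t ^ 2) = c t := by
    rw [← c_one_apply t]
    exact Function.update_eq_self 1 (c t)
  have hF' : HasFDerivAt f (fderiv ℝ f (c t)) (Function.update (c t) 1 (t ^ 2)) := by
    rw [hct]; exact hF
  have hcomp := hF'.comp_hasDerivAt (t ^ 2) (hasDerivAt_update (c t) 1 (t ^ 2))
  exact hcomp.unique (hasDerivAt_f_slice ht)

/-- The parabola is continuous and passes through the origin. -/
theorem tendsto_c : Tendsto c (𝓝[≠] 0) (𝓝 0) := by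
  have hc : Continuous c := by
    refine continuous_pi fun i => ?_
    fin_cases i <;> simp [c] <;> fun_prop
  have h := hc.tendsto 0
  rw [show c 0 = 0 by ext i; fin_cases i <;> simp [c]] at h
  exact h.mono_left nhdsWithin_le_nhds

/-- **`f` is differentiable everywhere but not `C¹`: its derivative is discontinuous at the origin.** -/
theorem not_continuousAt_fderiv_f : ¬ ContinuousAt (fderiv ℝ f) 0 := by
  intro hcont
  have h0 : fderiv ℝ f 0 = 0 := hasFDerivAt_f_zero.fderiv
  have hev : Continuous fun L : (Fin 2 → ℝ) →L[ℝ] ℝ => L (Pi.single 1 1) :=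
    continuous_id.clm_apply continuous_const
  have h1 : Tendsto (fun t => fderiv ℝ f (c t) (Pi.single 1 1)) (𝓝[≠] 0) (𝓝 (fderiv ℝ f 0 (Pi.single 1 1))) :=
    (hev.tendsto _).comp (hcont.tendsto.comp tendsto_c)
  have h1' : Tendsto (fun t => fderiv ℝ f (c t) (Pi.single 1 1)) (𝓝[≠] 0) (𝓝 0) := by simpa [h0] using h1
  have h2 : (fun t => fderiv ℝ f (c t) (Pi.single 1 1)) =ᶠ[𝓝[≠] (0 : ℝ)] fun _ => (1 / 2 : ℝ) :=
    eventually_nhdsWithin_of_forall fun t ht => fderiv_f_c_apply ht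
  have h3 : Tendsto (fun _ : ℝ => (1 / 2 : ℝ)) (𝓝[≠] 0) (𝓝 0) := h1'.congr' h2
  have := tendsto_nhds_unique h3 tendsto_const_nhds
  norm_num at this

/-- Everywhere differentiable. -/
theorem differentiable_f : Differentiable ℝ f := by
  intro p
  by_cases hp : p 0 ^ 4 + p 1 ^ 2 = 0
  · have h0 : p 0 = 0 := by
      have h4 : (0 : ℝ) ≤ p 0 ^ 4 := by positivity
      have : p 0 ^ 4 = 0 := by nlinarith [sq_nonneg (p 1)]
      exact pow_eq_zero_iff (by norm_num) |>.1 this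
    have h1 : p 1 = 0 := by
      have h4 : (0 : ℝ) ≤ p 0 ^ 4 := by positivity
      have : p 1 ^ 2 = 0 := by nlinarith [sq_nonneg (p 1)]
      exact pow_eq_zero_iff (by norm_num) |>.1 this
    have : p = 0 := by ext i; fin_cases i <;> simp [h0, h1]
    rw [this]
    exact hasFDerivAt_f_zero.differentiableAt
  · exact differentiableAt_f hp

/-- Summary: differentiable everywhere, NOT continuously differentiable. -/
theorem differentiable_and_not_contDiff : Differentiable ℝ f ∧ ¬ ContDiff ℝ 1 f :=
  ⟨differentiable_f, fun h => not_continuousAt_fderiv_f (h.continuous_fderiv one_ne_zero).continuousAt⟩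

end Summit.KontsevichZagierPeriods.KontsevichZagierPeriods.Theorems.PlanarSAZylev.Negative.NonC1
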